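import Mathlib
import Summits.AtomisticToContinuum.HydrodynamicLimit.Theorems.InformationPercolationEngineKickFairRelEquilibriumMesoTransferAE
import Summits.AtomisticToContinuum.HydrodynamicLimit.Theorems.InformationPercolationEngineKickFairRelEquilibriumMesoTransferSlots
import Summits.AtomisticToContinuum.HydrodynamicLimit.Theorems.InformationPercolationEngineKickFairRelEquilibriumMesoTransferKey
import Summits.AtomisticToContinuum.HydrodynamicLimit.Theorems.InformationPercolationEngineKickFairRelEquilibriumMesoPastMeasurable
import Literature.MathematicalPhysics.KineticTheory.EvenStatTruncationBound
import HarnessLib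

/-!
# `KickFairRelEquilibriumMeso`, line `Sketch` — FIRST KICKS ARE EXACTLY FAIR ON KEY LEVEL SETS
# (the `n = 0` part of the restart-bias stub R-i″, proved)

Helper file (`--supports stmt-AtomisticToContinuum-15177`, registered sub-goal `firstKickFair`) of the line lead. The
restart-bias stub `stub_restartBiasCut` asks that the windowed, past-weighted, `G`-centred kick sum have small
`G`-mean on a level set `B = {cellKey r w = β}` of the time-zero key. For the FIRST collision of each sphere (`n = 0`)
this mean is EXACTLY zero, for every mesh, key, window, bounded continuous `g` and measurable weight: the flight of
sphere `i` ending at its first collision starts at time `0` (`flightStart_nthCollisionTimeOf_zero`), so the first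
photo of the typed past `P_{i,0}` is the coarse configuration AT TIME ZERO (`past_zero_photo`), of which the key is a
measurable function (`photoKey`, `cellKey_eq_photoKey`); likewise `{0 < cnt_i}` and the window indicator are functions of
`t_{i,0}`, a component of the past (`cnt_pos_iff_nthCollisionTimeOf_mem`). Hence the weight
`1_B · 1{0 < cnt_i} · 1{t_{i,0} ∈ (t₁,t₂]} · h(P_{i,0})` is (a.e. equal to) a bounded `σ(P_{i,0})`-measurable function
`f`, and `∫ f · (g(X_{i,0}) − E_G[g(X_{i,0}) | σ(P_{i,0})]) dG = 0` by the pull-out property of the conditional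
expectation (`firstKickFair`). The content of R-i″ is therefore entirely in the LATER collisions (`n ≥ 1`), whose
pasts are photographed at positive times.
-/

noncomputable section

open MeasureTheory Set Filter Topology
open scoped ENNReal Classical

namespace Summit.AtomisticToContinuum.HydrodynamicLimit.Theorems.KickFairRelEquilibriumMesoLine

open Literature.Analysis.FluidPDE Literature.MathematicalPhysics.KineticTheory
open Summit.AtomisticToContinuum.HydrodynamicLimit.Theorems

variable {σ : ℝ} {N : ℕ}

/-! ## The key as a function of a coarse photo -/

/-- The binned cell data read off a coarse photo (cells and exact velocities of all spheres): per cell, the count,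
the binned total momentum and the binned (twice) kinetic energy — `cellKey` factors through it. [folklore] -/
def photoKey (w : ℝ) (ph : Fin (N + 1) → (Fin 3 → ℤ) × V3) (k : Fin 3 → ℤ) : ℕ × (Fin 3 → ℤ) × ℤ :=
  let I : Finset (Fin (N + 1)) := Finset.univ.filter fun i => (ph i).1 = k
  (I.card, fun j => ⌊(∑ i ∈ I, (ph i).2) j / w⌋, ⌊(∑ i ∈ I, ‖(ph i).2‖ ^ 2) / w⌋)

/-- `cellKey r w z` is `photoKey w` of the coarse configuration of `z` at mesh `r`. [folklore] -/
theorem cellKey_eq_photoKey (r w : ℝ) (z : Phase N) :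
    cellKey r w z = photoKey w (coarseConfig (Torus.coarseCell r) z) := by
  funext k
  simp only [cellKey, photoKey, coarseConfig_apply]

/-- Level sets of `photoKey` are measurable. [folklore] -/
theorem measurableSet_photoKey_eq (w : ℝ) (β : (Fin 3 → ℤ) → ℕ × (Fin 3 → ℤ) × ℤ) :
    MeasurableSet {ph : Fin (N + 1) → (Fin 3 → ℤ) × V3 | photoKey w ph = β} := by
  have hrepr : {ph : Fin (N + 1) → (Fin 3 → ℤ) × V3 | photoKey w ph = β} =
      ⋂ k : Fin 3 → ℤ, {ph | photoKey w ph k = β k} := by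
    ext ph; simp [funext_iff]
  rw [hrepr]
  refine MeasurableSet.iInter fun k => ?_
  have hcell : ∀ i : Fin (N + 1), Measurable fun ph : Fin (N + 1) → (Fin 3 → ℤ) × V3 => (ph i).1 :=
    fun i => (measurable_pi_apply i).fst
  have hsum : ∀ {F : (Fin (N + 1) → (Fin 3 → ℤ) × V3) → Fin (N + 1) → ℝ}, (∀ i, Measurable fun ph => F ph i) →
      Measurable fun ph : Fin (N + 1) → (Fin 3 → ℤ) × V3 =>
        ∑ i : Fin (N + 1), (if (ph i).1 = k then F ph i else 0) := fun hF =>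
    Finset.measurable_sum _ fun i _ => Measurable.ite ((hcell i) (measurableSet_singleton k)) (hF i) measurable_const
  have hc : Measurable fun ph : Fin (N + 1) → (Fin 3 → ℤ) × V3 =>
      ∑ i : Fin (N + 1), (if (ph i).1 = k then (1 : ℝ) else 0) := hsum fun _ => measurable_const
  have hp : ∀ j : Fin 3, Measurable fun ph : Fin (N + 1) → (Fin 3 → ℤ) × V3 =>
      ⌊(∑ i : Fin (N + 1), (if (ph i).1 = k then (ph i).2 j else 0)) / w⌋ := fun j =>
    Int.measurable_floor.comp ((hsum fun i =>
      (measurable_pi_apply j).comp ((WithLp.measurable_ofLp 2 (Fin 3 → ℝ)).comp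
        (measurable_pi_apply i).snd)).div_const w)
  have he : Measurable fun ph : Fin (N + 1) → (Fin 3 → ℤ) × V3 =>
      ⌊(∑ i : Fin (N + 1), (if (ph i).1 = k then ‖(ph i).2‖ ^ 2 else 0)) / w⌋ :=
    Int.measurable_floor.comp ((hsum fun i => ((measurable_pi_apply i).snd.norm.pow_const 2)).div_const w)
  have hcard : ∀ ph : Fin (N + 1) → (Fin 3 → ℤ) × V3,
      ((Finset.univ.filter fun i => (ph i).1 = k).card : ℝ) = ∑ i : Fin (N + 1), (if (ph i).1 = k then (1 : ℝ) else 0) :=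
    fun ph => by rw [Finset.card_filter]; push_cast; rfl
  have hvel : ∀ (ph : Fin (N + 1) → (Fin 3 → ℤ) × V3) (j : Fin 3),
      (∑ i ∈ Finset.univ.filter (fun i => (ph i).1 = k), (ph i).2) j =
        ∑ i : Fin (N + 1), (if (ph i).1 = k then (ph i).2 j else 0) := fun ph j => by
    rw [WithLp.ofLp_sum, Finset.sum_apply, Finset.sum_filter]
  have hen : ∀ ph : Fin (N + 1) → (Fin 3 → ℤ) × V3,
      ∑ i ∈ Finset.univ.filter (fun i => (ph i).1 = k), ‖(ph i).2‖ ^ 2 =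
        ∑ i : Fin (N + 1), (if (ph i).1 = k then ‖(ph i).2‖ ^ 2 else 0) := fun ph => by
    rw [Finset.sum_filter]
  have hset : {ph : Fin (N + 1) → (Fin 3 → ℤ) × V3 | photoKey w ph k = β k} =
      {ph | (∑ i : Fin (N + 1), (if (ph i).1 = k then (1 : ℝ) else 0)) = ((β k).1 : ℝ)} ∩
      ((⋂ j : Fin 3, {ph | ⌊(∑ i : Fin (N + 1), (if (ph i).1 = k then (ph i).2 j else 0)) / w⌋ = (β k).2.1 j}) ∩
        {ph | ⌊(∑ i : Fin (N + 1), (if (ph i).1 = k then ‖(ph i).2‖ ^ 2 else 0)) / w⌋ = (β k).2.2}) := by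
    ext ph
    simp only [mem_setOf_eq, mem_inter_iff, mem_iInter]
    rw [← hcard, ← hen]
    simp_rw [← hvel]
    constructor
    · intro hz
      have h1 := congrArg Prod.fst hz
      have h2 := congrArg (fun q => q.2.1) hz
      have h3 := congrArg (fun q => q.2.2) hz
      simp only [photoKey] at h1 h2 h3
      refine ⟨by exact_mod_cast h1, fun j => ?_, h3⟩
      exact congrFun h2 j
    · rintro ⟨h1, h2, h3⟩
      unfold photoKey
      ext
      · exact_mod_cast h1
      · exact h2 _
      · exact h3
  rw [hset]
  refine (measurableSet_eq_fun hc measurable_const).inter ((MeasurableSet.iInter fun j => ?_).inter ?_)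
  · exact measurableSet_eq_fun (hp j) measurable_const
  · exact measurableSet_eq_fun he measurable_const

/-! ## The first flight starts at time zero -/

/-- **The flight of `i` ending at its first collision time starts at `0`**: no collision time of `i` lies strictly
between `0` and `t_{i,0} = sInf (collision times of i in (0, ∞))`. [folklore] -/
theorem flightStart_nthCollisionTimeOf_zero (Φ : Flow σ N) (i : Fin (N + 1)) (z : Phase N) :
    flightStart (Torus.geometry (Fin 3)) (hsDiameter σ N) (fun s => Φ.flow s z) 0 i (Φ.nthCollisionTimeOf i 0 z) = 0 := by
  set S : Set ℝ := collisionTimesOf (Torus.geometry (Fin 3)) (hsDiameter σ N) (fun s => Φ.flow s z) i with hS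
  have ht₀ : Φ.nthCollisionTimeOf i 0 z = sInf (S ∩ Ioi 0) := by
    simp only [HardSphereFlow.nthCollisionTimeOf, Literature.Analysis.FluidPDE.nthCollisionTimeOf, nthTimeAfter_zero,
      nextTimeAfter, hS]
  have hempty : S ∩ Ioo 0 (Φ.nthCollisionTimeOf i 0 z) = ∅ := by
    ext s
    simp only [mem_inter_iff, mem_Ioo, mem_empty_iff_false, iff_false, not_and, not_lt]
    intro hs hs0
    rw [ht₀]
    exact csInf_le ⟨0, fun x hx => hx.2.le⟩ ⟨hs, hs0⟩
  unfold flightStart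
  rw [← hS, hempty, insert_empty_eq, csSup_singleton]

/-- **On the good set the first photo of the typed past `P_{i,0}` is the coarse configuration at time zero.** [folklore] -/
theorem past_zero_photo (Φ : Flow σ N) (r : ℝ) {z : Phase N} (hz : z ∈ Φ.good) (i : Fin (N + 1)) :
    (past Φ r z i 0).1.1.1 = coarseConfig (Torus.coarseCell r) z := by
  simp only [past, hz, if_true, HardSphereFlow.coarsePastOf, flightStart_nthCollisionTimeOf_zero, Φ.flow_zero z hz]

/-- **On the good set, `i` collides in `(0, τ]` iff its first collision time lies in `(0, τ]`.** [folklore] -/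
theorem cnt_pos_iff_nthCollisionTimeOf_mem (Φ : Flow σ N) (τ : ℝ) {z : Phase N} (hz : z ∈ Φ.good)
    (i : Fin (N + 1)) : 0 < cnt Φ τ z i ↔ Φ.nthCollisionTimeOf i 0 z ∈ Ioc 0 τ := by
  constructor
  · exact fun h => nthCollisionTimeOf_mem_Ioc_of_lt_cnt Φ τ z i h
  · intro ht
    set S : Set ℝ := collisionTimesOf (Torus.geometry (Fin 3)) (hsDiameter σ N) (fun s => Φ.flow s z) i with hS
    have hfin : ∀ b, (S ∩ Ioc 0 b).Finite := fun b =>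
      ((Φ.isTrajectory z hz).locFinite 0 b).subset
        (inter_subset_inter (collisionTimesOf_subset _ i) Ioc_subset_Icc_self)
    have ht₀ : Φ.nthCollisionTimeOf i 0 z = nextTimeAfter S 0 := by
      simp only [HardSphereFlow.nthCollisionTimeOf, Literature.Analysis.FluidPDE.nthCollisionTimeOf, nthTimeAfter_zero, hS]
    have hne : (S ∩ Ioi 0).Nonempty := by
      by_contra hne
      rw [not_nonempty_iff_eq_empty] at hne
      have := nextTimeAfter_of_eq_empty hne
      rw [← ht₀] at this
      exact absurd ht.1 (by rw [this]; exact lt_irrefl 0)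
    have hmem : Φ.nthCollisionTimeOf i 0 z ∈ S := by
      rw [ht₀]; exact (isLeast_nextTimeAfter hfin hne).1.1
    have hmem' : Φ.nthCollisionTimeOf i 0 z ∈ S ∩ Ioc 0 τ := ⟨hmem, ht⟩
    unfold cnt
    rw [← hS]
    exact (Set.ncard_pos (hfin τ)).2 ⟨_, hmem'⟩

/-! ## The first kicks are exactly fair on key level sets -/

/-- **Registered sub-goal `firstKickFair` (the `n = 0` part of R-i″, proved).** Under the invariant law
`G = localGibbsLaw σ 1 0 1 N Φ` (`σ ≤ 1/2`), for every mesh `r`, bin width `w`, horizon `τ`, window `(t₁, t₂]`,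
bounded continuous `g`, measurable weights `h` (any bound), key `β` and sphere `i`:
`∫_{cellKey r w = β} 1{0 < cnt_i} 1{t_{i,0} ∈ (t₁,t₂]} h_{i,0}(P_{i,0}) (g(X_{i,0}) − κ_{i,0}) dG = 0`. [folklore] -/
theorem firstKickFair : ∀ (σ : ℝ) (N : ℕ) (Φ : Flow σ N), 0 < σ → σ ≤ 1 / 2 → ∀ (τ r w t₁ t₂ : ℝ)
    (g : V3 × V3 × V3 → ℝ), Continuous g → (∃ C : ℝ, ∀ p, |g p| ≤ C) →
    ∀ (h : Fin (N + 1) → ℕ → Past N → ℝ), (∀ i n, Measurable (h i n)) → (∃ Ch : ℝ, ∀ i n p, |h i n p| ≤ Ch) →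
    ∀ (β : (Fin 3 → ℤ) → ℕ × (Fin 3 → ℤ) × ℤ) (i : Fin (N + 1)),
    ∫ z in {z | cellKey r w z = β},
      (if 0 < cnt Φ τ z i then
        (if t₁ < Φ.nthCollisionTimeOf i 0 z ∧ Φ.nthCollisionTimeOf i 0 z ≤ t₂ then (1 : ℝ) else 0) *
          (h i 0 (past Φ r z i 0) * (g (kick Φ i 0 z) - kappa Φ r g i 0 z)) else 0)
      ∂(localGibbsLaw σ (fun _ => 1) (fun _ => 0) (fun _ => 1) N Φ) = 0 := by
  intro σ N Φ hσ hσ2 τ r w t₁ t₂ g hg hgb h hh hhb β i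
  obtain ⟨C, hC⟩ := hgb
  obtain ⟨Ch, hCh⟩ := hhb
  set ν : Measure (Phase N) := localGibbsLaw σ (fun _ => (1 : ℝ)) (fun _ => (0 : V3)) (fun _ => (1 : ℝ)) N Φ with hν
  haveI : IsProbabilityMeasure ν := isProbabilityMeasure_localGibbsLaw continuous_const continuous_const
    continuous_const (fun _ => one_pos) (fun _ => one_pos) hσ2 N Φ
  have hνg : ν Φ.goodᶜ = 0 := localGibbsLaw_compl_good_eq_zero Φ
  have hgood : ∀ᵐ z ∂ν, z ∈ Φ.good := mem_ae_iff.2 hνg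
  -- the σ-algebra of the past of the first collision of `i` (written out; never a local instance)
  have hPm : Measurable (fun z => past Φ r z i 0) := (stub_pastMeasurable σ hσ N Φ r 0 i 0).1
  have hmle : MeasurableSpace.comap (fun z => past Φ r z i 0) inferInstance ≤
      (inferInstance : MeasurableSpace (Phase N)) := comap_past_le stub_pastMeasurable hσ Φ r i 0
  have hPm' : Measurable[MeasurableSpace.comap (fun z => past Φ r z i 0) inferInstance] (fun z => past Φ r z i 0) :=
    measurable_iff_comap_le.2 le_rfl
  -- the weight as a function of the past
  set S : Set (Past N) := {p | photoKey w p.1.1.1 = β ∧ p.2.2.2 ∈ Ioc 0 τ ∧ (t₁ < p.2.2.2 ∧ p.2.2.2 ≤ t₂)} with hSdef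
  have htime : Measurable fun p : Past N => p.2.2.2 := measurable_snd.snd.snd
  have hSm : MeasurableSet S := by
    refine MeasurableSet.inter ?_ (MeasurableSet.inter ?_ ?_)
    · exact (measurableSet_photoKey_eq w β).preimage measurable_fst.fst.fst
    · exact htime measurableSet_Ioc
    · exact (measurableSet_lt measurable_const htime).inter (measurableSet_le htime measurable_const)
  set F : Past N → ℝ := fun p => S.indicator (fun _ => (1 : ℝ)) p * h i 0 p with hFdef
  have hFm : Measurable F := ((measurable_const.indicator hSm).mul (hh i 0))
  have hFb : ∀ p, |F p| ≤ |Ch| := fun p => by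
    rw [hFdef]; dsimp only
    rw [abs_mul]
    have h1 : |S.indicator (fun _ => (1 : ℝ)) p| ≤ 1 := by
      by_cases hp : p ∈ S <;> simp [hp]
    calc |S.indicator (fun _ => (1 : ℝ)) p| * |h i 0 p| ≤ 1 * |Ch| :=
          mul_le_mul h1 ((hCh i 0 p).trans (le_abs_self _)) (abs_nonneg _) zero_le_one
      _ = |Ch| := one_mul _
  have hfm : Measurable[MeasurableSpace.comap (fun z => past Φ r z i 0) inferInstance] (fun z => F (past Φ r z i 0)) :=
    hFm.comp hPm'
  have hfm0 : Measurable (fun z => F (past Φ r z i 0)) := hFm.comp hPm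
  have hfb : ∀ᵐ z ∂ν, ‖F (past Φ r z i 0)‖ ≤ |Ch| :=
    Eventually.of_forall fun z => by rw [Real.norm_eq_abs]; exact hFb _
  -- the kick and its conditional expectation
  have hgkm : Measurable (fun z => g (kick Φ i 0 z)) := hg.measurable.comp (stub_pastMeasurable σ hσ N Φ r 0 i 0).2.1
  have hgkint : Integrable (fun z => g (kick Φ i 0 z)) ν :=
    Integrable.of_bound hgkm.aestronglyMeasurable C (Eventually.of_forall fun z => by
      rw [Real.norm_eq_abs]; exact hC _)
  have hκ : kappa Φ r g i 0 =
      ν[(fun z => g (kick Φ i 0 z)) | MeasurableSpace.comap (fun z => past Φ r z i 0) inferInstance] := rfl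
  have hfgint : Integrable (fun z => F (past Φ r z i 0) * g (kick Φ i 0 z)) ν :=
    hgkint.bdd_mul hfm0.aestronglyMeasurable hfb
  have hfκint : Integrable (fun z => F (past Φ r z i 0) * kappa Φ r g i 0 z) ν := by
    rw [hκ]; exact integrable_condExp.bdd_mul hfm0.aestronglyMeasurable hfb
  -- the pull-out identity: ∫ f (gk − E[gk|m]) = 0
  have hkey : ∫ z, F (past Φ r z i 0) * (g (kick Φ i 0 z) - kappa Φ r g i 0 z) ∂ν = 0 := by
    have hpull : ∫ z, F (past Φ r z i 0) * kappa Φ r g i 0 z ∂ν = ∫ z, F (past Φ r z i 0) * g (kick Φ i 0 z) ∂ν := by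
      rw [hκ]
      calc ∫ z, F (past Φ r z i 0) *
            (ν[(fun z => g (kick Φ i 0 z)) | MeasurableSpace.comap (fun z => past Φ r z i 0) inferInstance]) z ∂ν
          = ∫ z, (ν[(fun z => F (past Φ r z i 0) * g (kick Φ i 0 z)) |
              MeasurableSpace.comap (fun z => past Φ r z i 0) inferInstance]) z ∂ν :=
            integral_congr_ae (condExp_mul_of_stronglyMeasurable_left (f := fun z => F (past Φ r z i 0))
              (g := fun z => g (kick Φ i 0 z)) hfm.stronglyMeasurable hfgint hgkint).symm
        _ = ∫ z, F (past Φ r z i 0) * g (kick Φ i 0 z) ∂ν := integral_condExp hmle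
    simp_rw [mul_sub]
    rw [integral_sub hfgint hfκint, hpull, sub_self]
  -- identification of the integrand on the good set
  have hBm : MeasurableSet {z : Phase N | cellKey r w z = β} := measurableSet_cellKey_eq r w β
  rw [← integral_indicator hBm]
  refine (integral_congr_ae ?_).trans hkey
  filter_upwards [hgood] with z hz
  have hphoto : photoKey w (past Φ r z i 0).1.1.1 = cellKey r w z := by
    rw [past_zero_photo Φ r hz i, ← cellKey_eq_photoKey]
  have htz : (past Φ r z i 0).2.2.2 = Φ.nthCollisionTimeOf i 0 z := by simp [past, hz]
  have hcnt := cnt_pos_iff_nthCollisionTimeOf_mem Φ τ hz i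
  have hFz : F (past Φ r z i 0) = (if cellKey r w z = β ∧ Φ.nthCollisionTimeOf i 0 z ∈ Ioc 0 τ ∧
      (t₁ < Φ.nthCollisionTimeOf i 0 z ∧ Φ.nthCollisionTimeOf i 0 z ≤ t₂) then (1 : ℝ) else 0) * h i 0 (past Φ r z i 0) := by
    rw [hFdef]; dsimp only
    rw [indicator_apply]
    simp only [hSdef, mem_setOf_eq, hphoto, htz]
  simp only [indicator_apply, mem_setOf_eq, hFz]
  by_cases hB : cellKey r w z = β
  · by_cases hc : 0 < cnt Φ τ z i
    · have ht : Φ.nthCollisionTimeOf i 0 z ∈ Ioc 0 τ := hcnt.1 hc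
      by_cases hw : t₁ < Φ.nthCollisionTimeOf i 0 z ∧ Φ.nthCollisionTimeOf i 0 z ≤ t₂
      · simp [hB, hc, ht, hw]
      · simp [hB, hc, hw]
    · have ht : ¬ (Φ.nthCollisionTimeOf i 0 z ∈ Ioc 0 τ) := fun h' => hc (hcnt.2 h')
      simp [hB, hc, ht]
  · simp [hB]

end Summit.AtomisticToContinuum.HydrodynamicLimit.Theorems.KickFairRelEquilibriumMesoLine

end
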